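/-
Origin: expansion seat `prover-pub-hodgecm-mc-sinst-1-g11-0`, handover #1267 2026-08-21T03:47Z md5 cd3287f891c6 (297 l.; r3 re-stamp: ONE decl renamed cWZeroG_eq_torusScalar_oneG_finLineTorus → cWZeroG_eq_torusScalar_zeroG_finLineTorus + docstring wording vs r2 738140431416; NEW additive leaf, ns HodgeCM.Model.ThetaAdelicSide, = #1261 with η₀ GENERIC (hypotheses hη₀c, hη₀V, hη₀W : η₀(1, ũ) = 1 for rational ũ): twistCharW_bigCharZeroG_eq, adelicCharZeroG_cmCenter_symm_eq_one, twistCharW_bigCharZeroG_rationalToFinAdelic, cWZeroG_eq_torusScalar_zeroG_finLineTorus (r3 name), torusScalar_zeroG_symm_eq_one_of (tree char₃_eq_one_of_rational), cWZeroG_rationalToFinAdelic, psiZeroG_rationalToFinAdelic, charZeroDictG_rationalToFinAdelic, hasRationalRestriction_charZeroDictG_one (hχinf : ∀ t, χ(♯(t,1_f))·torusScalar_zeroG η₀ (u_t) = adelicCharZeroG η₀ (CMCenter (frameD V) u_t)) + _of_weight, continuous_torusScalar_zeroG_val_of, continuous_adelicCharZeroG_val, continuous_cWZeroG, continuous_twistCharW_bigCharZeroG,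 continuous_charZeroDictG, isLevelTrivial_charZeroDictG (UNCONDITIONAL), isAutChar_charZeroDictG + _of_weight; cert rc 0 / 32 s; #print axioms (both slot-0 files) 44/44 ⊆ trio, 0 proof-holeAx (work/AxSlotZero.lean); FQN 0 hits; NAMES for audit: HodgeCM.Model.ThetaAdelicSide.charZeroDictG_rationalToFinAdelic · HodgeCM.Model.ThetaAdelicSide.isLevelTrivial_charZeroDictG · HodgeCM.Model.ThetaAdelicSide.isAutChar_charZeroDictG) (`HOME/mc/pub-hodgecm-mc-sinst-1-g11/stage70/HodgeCM/Model/AdelicThetaSlotZeroAutG.lean`, md5 cd3287f891c6, 297 lines);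
landed by the gen-30 packager (p-g30) in gate run 71 as `HodgeCM/Model/AdelicThetaSlotZeroAutG.lean` (verbatim).
-/
/-
Copyright (c) 2026 the pub-hodgecm formalisation cell (harness21).  New file, not vendored.
Origin: session prover-pub-hodgecm-mc-sinst-1-g11-0 (unit pub-hodgecm-mc-sinst-1-g11, S-INSTANCE CONSTRUCTOR gen 11; the AUTOMORPHY of the
slot-0 dictionary character over the G-datum — #1261 with the slot character `η₀` GENERIC, twisted record `splitLineZeroTwistedG` of
`Model/AdelicThetaSlotZeroBridgeG`; the R2 pin of record is an instance), 2026-08-21.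
Intended final place: `HodgeCM/Model/AdelicThetaSlotZeroAutG.lean` (NEW additive model-layer leaf; imports sinst-1 `Model/AdelicThetaSlotZeroBridgeG`
and #1261 `Model/AdelicThetaDistributionAutZero`; nothing imports it; drop alone).
-/
import Summits.HodgeConjecture.HodgeCM.Model.AdelicThetaSlotZeroBridgeG
import Summits.HodgeConjecture.HodgeCM.Model.AdelicThetaDistributionAutZero

set_option autoImplicit false

/-!
# The slot-0 dictionary character `χ″₀(η₀, χ) = charZeroDictG η₀ χ` is automorphic ON THE WEIGHT SET modulo one archimedean identity

For a GENERIC slot character `η₀` (hypotheses: `hη₀c` continuity, `hη₀V : η₀(γ, 1) = 1` on `U(diag frameD V)(L⁺)`, `hη₀W : η₀(1, ũ) = 1` for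
rational `ũ`): `twistCharW_bigCharZeroG_eq`, `cWZeroG_eq_torusScalar_zeroG_finLineTorus`, `torusScalar_zeroG_symm_eq_one_of`,
**`charZeroDictG_rationalToFinAdelic`** (`χ″₀(γ_f) = adelicCharZeroG η₀ ((t_γ,1_f) · 1_V)⁻¹ · χ(♯(t_γ,1_f)) · torusScalar_zeroG η₀ (u_{t_γ})`),
**`hasRationalRestriction_charZeroDictG_one`** under `hχinf : ∀ t, χ(♯(t,1_f)) · torusScalar_zeroG η₀ (u_t) = adelicCharZeroG η₀ ((t,1_f) · 1_V)`
(= (Hw₀) on the weight set), `…_of_weight`; continuity ⇒ **`isLevelTrivial_charZeroDictG`** unconditionally; **`isAutChar_charZeroDictG`** (+ `_of_weight`).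
KERNEL only: 0 records, 0 `def … : Prop`, nothing cited as a hypothesis; `#print axioms` ⊆ {propext, Classical.choice, Quot.sound}.
-/

noncomputable section

open MulAction IsDedekindDomain NumberField.mixedEmbedding
open NumberField hiding relNormOneIdeles relNormOneRat probHaarRelNormOneQuot relNormOneInfUnits relNormOneInfToIdeles
open scoped Matrix TensorProduct Classical SchwartzMap
open Literature.NumberTheory.Automorphic Literature.NumberTheory.Weil1964
open Literature.NumberTheory.GelbartRogawski1991 Literature.NumberTheory.GelbartRogawski1991.UnitaryDualPair
open Literature.RepresentationTheory (SeesawScalar.twist SeesawScalar.twist_apply)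
open Literature.Geometry.ComplexHyperbolic.BallModel (U21 x₀)
open Literature.AlgebraicGeometry.ShimuraVarieties
open HodgeCM.Adelic HodgeCM.PerL34 HodgeCM.Model.ArchSideTerm HodgeCM.Model.ThetaDistFin
open Literature.NumberTheory.Automorphic.UnitaryGroup (cmAdelicOneEquivRelNormOne)

namespace HodgeCM.Model
namespace ThetaAdelicSide

variable {L : CMField} {ι₁ : L →+* ℂ} (V : HermSpace3 L ι₁) (c : SeesawCtx L)
  (hGR : (cmSplittingDatum (L : Type) finProdFinEquiv (frameD V) (frameD_real V) (frameD_ne V) (dW c.D) (dW_real c.D)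
    (dW_ne c.D)).CompatibleSplitting)
  (hGR₀ : (cmSplittingDatum (L : Type) (e₁) (frameD V) (frameD_real V) (frameD_ne V) (lineVec (L : Type) (dW c.D 0))
    (fun _ => dW_real c.D 0) (fun _ => dW_ne c.D 0)).CompatibleSplitting)
  (hGR₁ : (cmSplittingDatum (L : Type) (e₁) (frameD V) (frameD_real V) (frameD_ne V) (lineVec (L : Type) (dW c.D 1))
    (fun _ => dW_real c.D 1) (fun _ => dW_ne c.D 1)).CompatibleSplitting)
  (η₀ : CMAdelic (L : Type) (frameD V) × CMAdelicOne (L : Type) →* ℂˣ)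
  (hη₀c : Continuous fun p => ((η₀ p : ℂˣ) : ℂ))
  (hη₀V : ∀ v ∈ CMRat (L : Type) (frameD V), η₀ (v, 1) = 1)
  (hη₀W : ∀ t₀ ∈ relNormOneRat (↥(maximalRealSubfield L)) L, η₀ (1, (cmAdelicOneEquivRelNormOne (L : Type)).symm t₀) = 1)
  (h₁W : (∀ j, 0 < (ι₁ (dW c.D j)).re) ∨ ∀ j, (ι₁ (dW c.D j)).re < 0)
  (χ : PontryaginDual (↥(relNormOneIdeles (↥(maximalRealSubfield L)) L) ⧸ relNormOneRat (↥(maximalRealSubfield L)) L))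

/-! ## § 1. Values on rational points -/


/-- **`twistCharW ĉ₀(η₀) u = adelicCharZeroG η₀ ((det (1_∞, u)) · 1_V)`**. -/
theorem twistCharW_bigCharZeroG_eq (u : UfZero c.D) :
    HodgeCM.WeilCoinv.twistCharW (↥(maximalRealSubfield L)) (L : Type) (IsCMField.complexConj L) 3 1
        (Matrix.diagonal (frameD V)) (splitLineZero V c hGR₀).JW (bigCharZeroG V c hGR hGR₀ hGR₁ η₀) u =
      adelicCharZeroG V c hGR hGR₀ hGR₁ η₀ (CMCenter (L : Type) (frameD V) (finLineTorus (L : Type) (dW c.D 0) (dW_ne c.D 0) u)) := by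
  show HodgeCM.WeilCoinv.twistCharW (↥(maximalRealSubfield L)) (L : Type) (IsCMField.complexConj L) 3 1
      (Matrix.diagonal (frameD V)) (Matrix.diagonal (lineVec (L : Type) (dW c.D 0))) (bigCharZeroG V c hGR hGR₀ hGR₁ η₀) u = _
  rw [bigCharZeroG, LinePair.twistCharW_bigCharOfV_apply, adelicLinePairEquiv_adelicInr_eq_cmCenter, finLineTorus_apply]

include hη₀V in
/-- `adelicCharZeroG η₀` is trivial on the RATIONAL centre. -/
theorem adelicCharZeroG_cmCenter_symm_eq_one {t₀ : ↥(relNormOneIdeles (↥(maximalRealSubfield L)) L)}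
    (ht₀ : t₀ ∈ relNormOneRat (↥(maximalRealSubfield L)) L) :
    adelicCharZeroG V c hGR hGR₀ hGR₁ η₀ (CMCenter (L : Type) (frameD V) ((cmAdelicOneEquivRelNormOne (L : Type)).symm t₀)) = 1 :=
  adelicCharZeroG_eq_one_of_rat V c hGR hGR₀ hGR₁ η₀ hη₀V
    (UnitaryGroup.cm_adelicCenter_symm_mem_range_toAdelic (L : Type) 3 (Matrix.diagonal (frameD V)) t₀ ht₀)

include hη₀V in
/-- **`twistCharW ĉ₀(η₀) (γ_f) = adelicCharZeroG η₀ ((t_γ, 1_f) · 1_V)⁻¹`** on a rational point. -/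
theorem twistCharW_bigCharZeroG_rationalToFinAdelic
    (γ : ↥(UnitaryGroup.rational (↥(maximalRealSubfield L)) (L : Type) (IsCMField.complexConj L) 1
      (Matrix.diagonal (lineVec (L : Type) (dW c.D 0))))) :
    HodgeCM.WeilCoinv.twistCharW (↥(maximalRealSubfield L)) (L : Type) (IsCMField.complexConj L) 3 1
        (Matrix.diagonal (frameD V)) (splitLineZero V c hGR₀).JW (bigCharZeroG V c hGR hGR₀ hGR₁ η₀)
        (UnitaryGroup.rationalToFinAdelic (↥(maximalRealSubfield L)) (L : Type) (IsCMField.complexConj L) 1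
          (Matrix.diagonal (lineVec (L : Type) (dW c.D 0))) γ) =
      (adelicCharZeroG V c hGR hGR₀ hGR₁ η₀ (CMCenter (L : Type) (frameD V) (ratInfOne (L : Type) (dW c.D 0) (dW_ne c.D 0) γ)))⁻¹ := by
  rw [twistCharW_bigCharZeroG_eq, finLineTorus_rationalToFinAdelic, map_mul, map_inv, map_mul, map_inv,
    adelicCharZeroG_cmCenter_symm_eq_one V c hGR hGR₀ hGR₁ η₀ hη₀V (ratDetIdele_mem_relNormOneRat (L : Type) (dW c.D 0) (dW_ne c.D 0) γ),
    mul_one]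
  rfl

/-- `cWZeroG η₀ = torusScalar_zeroG η₀ ∘ finLineTorus`. -/
theorem cWZeroG_eq_torusScalar_zeroG_finLineTorus (u : UfZero c.D) :
    cWZeroG V c hGR hGR₀ hGR₁ η₀ u =
      torusScalar_zeroG V c.D hGR hGR₀ hGR₁ η₀ (finLineTorus (L : Type) (dW c.D 0) (dW_ne c.D 0) u) := by
  rw [cWZeroG_apply, finCharZero_apply, finPairD_apply, map_one, map_one, torusScalar_zero_applyG, cmCenter_finLineTorus]
  rfl

include hη₀W in
/-- the torus scalar of line 0 at `η₀` is trivial on RATIONAL points (`hη₀W` + [Weil1964, Thm 6] `char₄_eq_one_of_rational`). -/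
theorem torusScalar_zeroG_symm_eq_one_of {t₀ : ↥(relNormOneIdeles (↥(maximalRealSubfield L)) L)}
    (ht₀ : t₀ ∈ relNormOneRat (↥(maximalRealSubfield L)) L) :
    torusScalar_zeroG V c.D hGR hGR₀ hGR₁ η₀ ((cmAdelicOneEquivRelNormOne (L : Type)).symm t₀) = 1 := by
  obtain ⟨γ₀, hγ₀⟩ := UnitaryGroup.cm_adelicCenter_symm_mem_range_toAdelic (L : Type) 1
    (Matrix.diagonal (lineVec (L : Type) (dW c.D 0))) t₀ ht₀
  have hχ1 : cmLineChar₀ (L : Type) finProdFinEquiv e₁ (frameD V) (frameD_real V) (frameD_ne V) (dW c.D) (dW_real c.D) (dW_ne c.D)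
      hGR hGR₀ hGR₁ (1, CMCenter (L : Type) (lineVec (L : Type) (dW c.D 0)) ((cmAdelicOneEquivRelNormOne (L : Type)).symm t₀)) = 1 := by
    rw [cmLineChar₀]
    simp only [MonoidHom.mul_apply, MonoidHom.coe_comp, Function.comp_apply, MonoidHom.coe_fst, MonoidHom.coe_snd, map_one, one_mul]
    apply char₃_eq_one_of_rational
    · exact ratIsometry_one_lineVec (L : Type) (dW c.D)
    · exact ⟨γ₀, hγ₀⟩
  rw [torusScalar_zero_applyG, hη₀W t₀ ht₀, hχ1, mul_one]

include hη₀W in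
/-- `cWZeroG η₀ (γ_f) = torusScalar_zeroG η₀ (u_{t_γ})⁻¹`. -/
theorem cWZeroG_rationalToFinAdelic
    (γ : ↥(UnitaryGroup.rational (↥(maximalRealSubfield L)) (L : Type) (IsCMField.complexConj L) 1
      (Matrix.diagonal (lineVec (L : Type) (dW c.D 0))))) :
    cWZeroG V c hGR hGR₀ hGR₁ η₀ (UnitaryGroup.rationalToFinAdelic (↥(maximalRealSubfield L)) (L : Type) (IsCMField.complexConj L) 1
        (Matrix.diagonal (lineVec (L : Type) (dW c.D 0))) γ) =
      (torusScalar_zeroG V c.D hGR hGR₀ hGR₁ η₀ (ratInfOne (L : Type) (dW c.D 0) (dW_ne c.D 0) γ))⁻¹ := by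
  rw [cWZeroG_eq_torusScalar_zeroG_finLineTorus, finLineTorus_rationalToFinAdelic, map_mul, map_inv,
    torusScalar_zeroG_symm_eq_one_of V c hGR hGR₀ hGR₁ η₀ hη₀W (ratDetIdele_mem_relNormOneRat (L : Type) (dW c.D 0) (dW_ne c.D 0) γ),
    mul_one]
  rfl

include hη₀W in
/-- `ψ₀(η₀, χ)(γ_f) = χ(♯(t_γ, 1_f)) · torusScalar_zeroG η₀ (u_{t_γ})`. -/
theorem psiZeroG_rationalToFinAdelic
    (γ : ↥(UnitaryGroup.rational (↥(maximalRealSubfield L)) (L : Type) (IsCMField.complexConj L) 1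
      (Matrix.diagonal (lineVec (L : Type) (dW c.D 0))))) :
    psiZeroG V c hGR hGR₀ hGR₁ η₀ χ (UnitaryGroup.rationalToFinAdelic (↥(maximalRealSubfield L)) (L : Type) (IsCMField.complexConj L) 1
        (Matrix.diagonal (lineVec (L : Type) (dW c.D 0))) γ) =
      Circle.toUnits (χ (QuotientGroup.mk
          (relNormOneInfToIdeles (↥(maximalRealSubfield L)) L (ratInfPart (L : Type) (dW c.D 0) (dW_ne c.D 0) γ)))) *
        torusScalar_zeroG V c.D hGR hGR₀ hGR₁ η₀ (ratInfOne (L : Type) (dW c.D 0) (dW_ne c.D 0) γ) := by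
  rw [psiZeroG, MonoidHom.mul_apply, MonoidHom.inv_apply, chiZero_rationalToFinAdelic, cWZeroG_rationalToFinAdelic V c hGR hGR₀ hGR₁ η₀ hη₀W,
    inv_inv]

include hη₀V hη₀W in
/-- **`χ″₀(γ_f) = adelicCharZeroG η₀ ((t_γ,1_f) · 1_V)⁻¹ · (χ(♯(t_γ, 1_f)) · torusScalar_zeroG η₀ (u_{t_γ}))`** — an ARCHIMEDEAN quantity. -/
theorem charZeroDictG_rationalToFinAdelic
    (γ : ↥(UnitaryGroup.rational (↥(maximalRealSubfield L)) (L : Type) (IsCMField.complexConj L) 1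
      (Matrix.diagonal (lineVec (L : Type) (dW c.D 0))))) :
    charZeroDictG V c hGR hGR₀ hGR₁ η₀ χ (UnitaryGroup.rationalToFinAdelic (↥(maximalRealSubfield L)) (L : Type)
        (IsCMField.complexConj L) 1 (Matrix.diagonal (lineVec (L : Type) (dW c.D 0))) γ) =
      (adelicCharZeroG V c hGR hGR₀ hGR₁ η₀ (CMCenter (L : Type) (frameD V) (ratInfOne (L : Type) (dW c.D 0) (dW_ne c.D 0) γ)))⁻¹ *
        (Circle.toUnits (χ (QuotientGroup.mk
            (relNormOneInfToIdeles (↥(maximalRealSubfield L)) L (ratInfPart (L : Type) (dW c.D 0) (dW_ne c.D 0) γ)))) *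
          torusScalar_zeroG V c.D hGR hGR₀ hGR₁ η₀ (ratInfOne (L : Type) (dW c.D 0) (dW_ne c.D 0) γ)) := by
  rw [charZeroDictG, MonoidHom.mul_apply, twistCharW_bigCharZeroG_rationalToFinAdelic V c hGR hGR₀ hGR₁ η₀ hη₀V]
  exact congrArg _ (psiZeroG_rationalToFinAdelic V c hGR hGR₀ hGR₁ η₀ hη₀W χ γ)

/-! ## § 2. Rational triviality from ONE archimedean identity -/

include hη₀V hη₀W in
/-- **`χ″₀` IS TRIVIAL ON `U(⟨a₀⟩)(L⁺)`** as soon as `χ(♯(t,1_f)) · torusScalar_zeroG η₀ (u_t) = adelicCharZeroG η₀ ((t,1_f) · 1_V)` on the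
archimedean torus. -/
theorem hasRationalRestriction_charZeroDictG_one
    (hχinf : ∀ t : ↥(relNormOneInfUnits (↥(maximalRealSubfield L)) L),
      ((χ (QuotientGroup.mk (relNormOneInfToIdeles (↥(maximalRealSubfield L)) L t)) : Circle) : ℂ) *
          ((torusScalar_zeroG V c.D hGR hGR₀ hGR₁ η₀
            ((cmAdelicOneEquivRelNormOne (L : Type)).symm (relNormOneInfToIdeles (↥(maximalRealSubfield L)) L t)) : ℂˣ) : ℂ) =
        ((adelicCharZeroG V c hGR hGR₀ hGR₁ η₀ (CMCenter (L : Type) (frameD V)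
            ((cmAdelicOneEquivRelNormOne (L : Type)).symm (relNormOneInfToIdeles (↥(maximalRealSubfield L)) L t))) : ℂˣ) : ℂ)) :
    (splitLineZeroTwistedG V c hGR hGR₀ hGR₁ η₀ hη₀V).HasRationalRestriction (charZeroDictG V c hGR hGR₀ hGR₁ η₀ χ) 1 := by
  rw [SplitLine.hasRationalRestriction_iff]
  intro γ
  have h := charZeroDictG_rationalToFinAdelic V c hGR hGR₀ hGR₁ η₀ hη₀V hη₀W χ γ
  have hne : adelicCharZeroG V c hGR hGR₀ hGR₁ η₀ (CMCenter (L : Type) (frameD V) (ratInfOne (L : Type) (dW c.D 0) (dW_ne c.D 0) γ)) *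
      1 = adelicCharZeroG V c hGR hGR₀ hGR₁ η₀ (CMCenter (L : Type) (frameD V) (ratInfOne (L : Type) (dW c.D 0) (dW_ne c.D 0) γ)) *
        ((adelicCharZeroG V c hGR hGR₀ hGR₁ η₀ (CMCenter (L : Type) (frameD V) (ratInfOne (L : Type) (dW c.D 0) (dW_ne c.D 0) γ)))⁻¹ *
          (Circle.toUnits (χ (QuotientGroup.mk
              (relNormOneInfToIdeles (↥(maximalRealSubfield L)) L (ratInfPart (L : Type) (dW c.D 0) (dW_ne c.D 0) γ)))) *
            torusScalar_zeroG V c.D hGR hGR₀ hGR₁ η₀ (ratInfOne (L : Type) (dW c.D 0) (dW_ne c.D 0) γ))) := by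
    rw [mul_one, mul_inv_cancel_left]
    apply Units.ext
    rw [Units.val_mul]
    exact (hχinf _).symm
  rw [MonoidHom.one_apply]
  exact h.trans (mul_left_cancel hne).symm

include hη₀V hη₀W in
/-- the same from the WEIGHT identity and (Hw₀) `w t · adelicCharZeroG η₀ ((t,1_f) · 1_V) = torusScalar_zeroG η₀ (u_t)`. -/
theorem hasRationalRestriction_charZeroDictG_one_of_weight (w : ↥(relNormOneInfUnits (↥(maximalRealSubfield L)) L) → ℂ)
    (hχw : ∀ t : ↥(relNormOneInfUnits (↥(maximalRealSubfield L)) L),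
      ((χ (QuotientGroup.mk (relNormOneInfToIdeles (↥(maximalRealSubfield L)) L t)) : Circle) : ℂ) * w t = 1)
    (hw : ∀ t : ↥(relNormOneInfUnits (↥(maximalRealSubfield L)) L),
      w t * ((adelicCharZeroG V c hGR hGR₀ hGR₁ η₀ (CMCenter (L : Type) (frameD V)
            ((cmAdelicOneEquivRelNormOne (L : Type)).symm (relNormOneInfToIdeles (↥(maximalRealSubfield L)) L t))) : ℂˣ) : ℂ) =
        ((torusScalar_zeroG V c.D hGR hGR₀ hGR₁ η₀
            ((cmAdelicOneEquivRelNormOne (L : Type)).symm (relNormOneInfToIdeles (↥(maximalRealSubfield L)) L t)) : ℂˣ) : ℂ)) :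
    (splitLineZeroTwistedG V c hGR hGR₀ hGR₁ η₀ hη₀V).HasRationalRestriction (charZeroDictG V c hGR hGR₀ hGR₁ η₀ χ) 1 := by
  refine hasRationalRestriction_charZeroDictG_one V c hGR hGR₀ hGR₁ η₀ hη₀V hη₀W χ fun t => ?_
  rw [← hw t, ← mul_assoc, hχw t, one_mul]

/-! ## § 3. Level triviality (continuity) and `IsAutChar` -/

include hη₀c h₁W in
/-- carch's torus scalar of line 0 at `η₀` has continuous values. -/
theorem continuous_torusScalar_zeroG_val_of :
    Continuous fun u : CMAdelicOne (L : Type) => ((torusScalar_zeroG V c.D hGR hGR₀ hGR₁ η₀ u : ℂˣ) : ℂ) := by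
  have h1 : Continuous fun u : CMAdelicOne (L : Type) => ((η₀ (1, u) : ℂˣ) : ℂ) := hη₀c.comp (continuous_const.prodMk continuous_id)
  have h2 : Continuous fun u : CMAdelicOne (L : Type) =>
      ((cmLineChar₀ (L : Type) finProdFinEquiv e₁ (frameD V) (frameD_real V) (frameD_ne V) (dW c.D) (dW_real c.D) (dW_ne c.D) hGR hGR₀
        hGR₁ (1, CMCenter (L : Type) (lineVec (L : Type) (dW c.D 0)) u) : ℂˣ) : ℂ) :=
    (continuous_cmLineChar₀_of_signs (L : Type) finProdFinEquiv e₁ (frameD V) (frameD_real V) (frameD_ne V) (dW c.D) (dW_real c.D)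
        (dW_ne c.D) hGR hGR₀ hGR₁ ι₁ (frameD_sign_ι₁' V) h₁W (frameD_sign_of_ne V)).comp
      (continuous_const.prodMk (continuous_adelicCenter _ _ _ _ _))
  simp only [torusScalar_zero_applyG, Units.val_mul]
  exact h1.mul h2

include hη₀c h₁W in
/-- the adelic `V`-character `adelicCharZeroG η₀` has continuous values. -/
theorem continuous_adelicCharZeroG_val :
    Continuous fun v : CMAdelic (L : Type) (frameD V) => ((adelicCharZeroG V c hGR hGR₀ hGR₁ η₀ v : ℂˣ) : ℂ) := by
  have h1 : Continuous fun v : CMAdelic (L : Type) (frameD V) => ((η₀ (v, 1) : ℂˣ) : ℂ) := hη₀c.comp (continuous_id.prodMk continuous_const)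
  have h2 : Continuous fun v : CMAdelic (L : Type) (frameD V) =>
      ((cmLineChar₀ (L : Type) finProdFinEquiv e₁ (frameD V) (frameD_real V) (frameD_ne V) (dW c.D) (dW_real c.D) (dW_ne c.D) hGR hGR₀
        hGR₁ (v, 1) : ℂˣ) : ℂ) :=
    (continuous_cmLineChar₀_of_signs (L : Type) finProdFinEquiv e₁ (frameD V) (frameD_real V) (frameD_ne V) (dW c.D) (dW_real c.D)
        (dW_ne c.D) hGR hGR₀ hGR₁ ι₁ (frameD_sign_ι₁' V) h₁W (frameD_sign_of_ne V)).comp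
      (continuous_id.prodMk continuous_const)
  simp only [adelicCharZeroG_apply, Units.val_mul]
  exact h1.mul h2

include hη₀c h₁W in
/-- `cWZeroG η₀` is continuous (into `ℂˣ`). -/
theorem continuous_cWZeroG : Continuous (cWZeroG V c hGR hGR₀ hGR₁ η₀) := by
  apply (cWZeroG V c hGR hGR₀ hGR₁ η₀).continuous_of_continuous_units_val
  have hf : Continuous (finLineTorus (L : Type) (dW c.D 0) (dW_ne c.D 0)) :=
    (continuous_cmAdelicDet (L : Type) (lineVec (L : Type) (dW c.D 0)) fun _ => dW_ne c.D 0).comp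
      (UnitaryGroup.continuous_finAdelicToAdelic _ _ _ _ _)
  simp only [cWZeroG_eq_torusScalar_zeroG_finLineTorus]
  exact (continuous_torusScalar_zeroG_val_of V c hGR hGR₀ hGR₁ η₀ hη₀c h₁W).comp hf

include hη₀c h₁W in
/-- the `W`-part of `ĉ₀(η₀)` is continuous (into `ℂˣ`). -/
theorem continuous_twistCharW_bigCharZeroG :
    Continuous (HodgeCM.WeilCoinv.twistCharW (↥(maximalRealSubfield L)) (L : Type) (IsCMField.complexConj L) 3 1
      (Matrix.diagonal (frameD V)) (splitLineZero V c hGR₀).JW (bigCharZeroG V c hGR hGR₀ hGR₁ η₀)) := by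
  apply MonoidHom.continuous_of_continuous_units_val
  have hf : Continuous (finLineTorus (L : Type) (dW c.D 0) (dW_ne c.D 0)) :=
    (continuous_cmAdelicDet (L : Type) (lineVec (L : Type) (dW c.D 0)) fun _ => dW_ne c.D 0).comp
      (UnitaryGroup.continuous_finAdelicToAdelic _ _ _ _ _)
  simp only [twistCharW_bigCharZeroG_eq]
  exact (continuous_adelicCharZeroG_val V c hGR hGR₀ hGR₁ η₀ hη₀c h₁W).comp ((continuous_adelicCenter _ _ _ _ _).comp hf)

include hη₀c h₁W in
/-- `χ″₀` is continuous (into `ℂˣ`). -/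
theorem continuous_charZeroDictG : Continuous (charZeroDictG V c hGR hGR₀ hGR₁ η₀ χ) := by
  show Continuous fun u =>
    HodgeCM.WeilCoinv.twistCharW (↥(maximalRealSubfield L)) (L : Type) (IsCMField.complexConj L) 3 1
        (Matrix.diagonal (frameD V)) (splitLineZero V c hGR₀).JW (bigCharZeroG V c hGR hGR₀ hGR₁ η₀) u *
      (chiZero c χ u * (cWZeroG V c hGR hGR₀ hGR₁ η₀ u)⁻¹)
  exact (continuous_twistCharW_bigCharZeroG V c hGR hGR₀ hGR₁ η₀ hη₀c h₁W).mul
    ((continuous_chiZero c χ).mul (continuous_cWZeroG V c hGR hGR₀ hGR₁ η₀ hη₀c h₁W).inv)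

include hη₀c h₁W in
/-- **`χ″₀` IS LEVEL-TRIVIAL** on the twisted slot-0 record — unconditionally. -/
theorem isLevelTrivial_charZeroDictG :
    (splitLineZeroTwistedG V c hGR hGR₀ hGR₁ η₀ hη₀V).IsLevelTrivial (charZeroDictG V c hGR hGR₀ hGR₁ η₀ χ) := by
  obtain ⟨n₀, hn₀, h⟩ := UnitaryGroup.exists_nat_forall_dvd_finCongruenceLevel_le_ker (charZeroDictG V c hGR hGR₀ hGR₁ η₀ χ)
    (continuous_charZeroDictG V c hGR hGR₀ hGR₁ η₀ hη₀c h₁W χ).continuousAt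
  exact ⟨n₀, hn₀, fun k hk => h n₀ hn₀ (dvd_refl _) k hk⟩

include hη₀c hη₀W h₁W in
/-- **`χ″₀ = charZeroDictG η₀ χ` IS A `GoodChar` OF THE TWISTED SLOT-0 RECORD** (`IsAutChar`) under the ONE archimedean identity — binder-2's
socket hypothesis `hχ` for slot 0, at every pin. -/
theorem isAutChar_charZeroDictG
    (hχinf : ∀ t : ↥(relNormOneInfUnits (↥(maximalRealSubfield L)) L),
      ((χ (QuotientGroup.mk (relNormOneInfToIdeles (↥(maximalRealSubfield L)) L t)) : Circle) : ℂ) *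
          ((torusScalar_zeroG V c.D hGR hGR₀ hGR₁ η₀
            ((cmAdelicOneEquivRelNormOne (L : Type)).symm (relNormOneInfToIdeles (↥(maximalRealSubfield L)) L t)) : ℂˣ) : ℂ) =
        ((adelicCharZeroG V c hGR hGR₀ hGR₁ η₀ (CMCenter (L : Type) (frameD V)
            ((cmAdelicOneEquivRelNormOne (L : Type)).symm (relNormOneInfToIdeles (↥(maximalRealSubfield L)) L t))) : ℂˣ) : ℂ)) :
    (splitLineZeroTwistedG V c hGR hGR₀ hGR₁ η₀ hη₀V).IsAutChar (charZeroDictG V c hGR hGR₀ hGR₁ η₀ χ) :=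
  ⟨isLevelTrivial_charZeroDictG V c hGR hGR₀ hGR₁ η₀ hη₀c hη₀V h₁W χ,
    hasRationalRestriction_charZeroDictG_one V c hGR hGR₀ hGR₁ η₀ hη₀V hη₀W χ hχinf⟩

include hη₀c hη₀W h₁W in
/-- the same from the WEIGHT identity and (Hw₀). -/
theorem isAutChar_charZeroDictG_of_weight (w : ↥(relNormOneInfUnits (↥(maximalRealSubfield L)) L) → ℂ)
    (hχw : ∀ t : ↥(relNormOneInfUnits (↥(maximalRealSubfield L)) L),
      ((χ (QuotientGroup.mk (relNormOneInfToIdeles (↥(maximalRealSubfield L)) L t)) : Circle) : ℂ) * w t = 1)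
    (hw : ∀ t : ↥(relNormOneInfUnits (↥(maximalRealSubfield L)) L),
      w t * ((adelicCharZeroG V c hGR hGR₀ hGR₁ η₀ (CMCenter (L : Type) (frameD V)
            ((cmAdelicOneEquivRelNormOne (L : Type)).symm (relNormOneInfToIdeles (↥(maximalRealSubfield L)) L t))) : ℂˣ) : ℂ) =
        ((torusScalar_zeroG V c.D hGR hGR₀ hGR₁ η₀
            ((cmAdelicOneEquivRelNormOne (L : Type)).symm (relNormOneInfToIdeles (↥(maximalRealSubfield L)) L t)) : ℂˣ) : ℂ)) :
    (splitLineZeroTwistedG V c hGR hGR₀ hGR₁ η₀ hη₀V).IsAutChar (charZeroDictG V c hGR hGR₀ hGR₁ η₀ χ) :=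
  ⟨isLevelTrivial_charZeroDictG V c hGR hGR₀ hGR₁ η₀ hη₀c hη₀V h₁W χ,
    hasRationalRestriction_charZeroDictG_one_of_weight V c hGR hGR₀ hGR₁ η₀ hη₀V hη₀W χ w hχw hw⟩

end ThetaAdelicSide
end HodgeCM.Model

end
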